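import Summits.CriticalPhenomena.PercolationContinuityZ3.Theorems.PercNearOneGluingNoHeavyQuantDECAtTarget
import HarnessLib

/-!
# QUANT lane R8, T-DEC: bookkeeping for `LawDec.DECAtT` — raising the top, the SHIFT LEMMA WITH THE DOUBLE TARGET BONUS
# (`T ↦ T + 2s`), and FINITE MIXTURES at a common target

builds on p205010 (kernel theorem, internal audit signed; external expert review pending)

Support file (`--supports stmt-CriticalPhenomena-4575`), QUANT lane typer seat prim-quant-stmt (gen 22), rung R8 of
`run/shared/lean/prim/quant/LADDER.md`.  Theorems only, standard axioms, no sorries.  Continues `…QuantDECAtTarget` (typer g19: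
`DECAtT`, `decAtT_antitone_target`, `decAtT_mixture`) and census-2 g53's `…QuantLawDecShift` (`decAt_shift`, target `T + s` at the mean).

* `LawDec.decAtT_mono_top` — a decomposition on `{0..M}` is one on `{0..M′}`, `M ≤ M′`.
* **`LawDec.decAtT_shift_two`** — DEC(j′) at target `T` for `ν` ⟹ DEC(j′+s) at target **`T + 2s`** for the `s`-shifted law
  `h ↦ ν(h−s)·[s ≤ h]`: sure mass counts double (rule (S): `2(k+s) ≥ T + 2s`; rule (N): credit `2(lo+s) + (hi−lo)κ ≥ T + 2s`; rule (G)
  unchanged).  DEC-CLOSURE-G53 §1 (F1) notes this bonus; `decAt_shift` only records `T + s` (the shifted MEAN).  It is what makes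
  convolution arguments work component-wise: `μ₁ ∗ {lo, hi; g} = shift_lo (slice μ₁ (hi−lo) g)` is certified at `T₁ + credit`, not `T₁ + mean`.
* `LawDec.decAtT_finite_mixture` — if `μ = Σ_r w_r·ν_r` (finitely many, `w ≥ 0`, `Σ w = 1`) and every CHARGED `ν_r` is DEC(j′) at the
  common target `T` on `{0..M}`, then so is `μ` (dependent choice of the decompositions, sigma type of the index types).

[this work]; DEC rules ARCH-TREES-G49 §2.2 / DEC-TAMP-G50 §3.1 (this lane).  The gluing rows served
[cite: KozmaNitzan2024, Conjecture 3 (p. 15)]; product measure [cite: Grimmett1999, §1.3 p. 10].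
-/

noncomputable section

namespace Summit.CriticalPhenomena.PercolationContinuityZ3.Theorems

namespace Quant

open Finset

/-- the two-point law `{lo, hi; g}` (as in `…QuantLawDEC`) -/
local notation3 "TP[" lo ", " hi ", " g ", " h "]" =>
  (g : ℝ) * (if (h : ℕ) = (hi : ℕ) then (1 : ℝ) else 0) + (1 - (g : ℝ)) * (if (h : ℕ) = (lo : ℕ) then (1 : ℝ) else 0)

namespace LawDec

/-- **raising the top**: `DECAtT x T j′ M μ → M ≤ M′ → DECAtT x T j′ M′ μ`. [this work] -/
theorem decAtT_mono_top {x T : ℝ} {j' M M' : ℕ} {μ : ℕ → ℝ} (h : DECAtT x T j' M μ) (hMM : M ≤ M') :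
    DECAtT x T j' M' μ := by
  obtain ⟨ρ, hρ, lam, g, lo, hi, h0, h1, hg, hlohi, hhi, hμ, hval⟩ := h
  exact ⟨ρ, hρ, lam, g, lo, hi, h0, h1, hg, hlohi, fun r => (hhi r).trans hMM, hμ, hval⟩

/-- **THE SHIFT LEMMA WITH THE DOUBLE TARGET BONUS.**  If `ν` is DEC(j′) at target `T` on `{0..M}`, then the law shifted up by
`s`, `h ↦ ν(h−s)·[s ≤ h]`, is DEC(j′+s) at target `T + 2s` on `{0..M+s}` (same floor, same gates; components `{lo+s, hi+s; g}`).
[this work] -/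
theorem decAtT_shift_two (x T : ℝ) (j' M s : ℕ) (ν : ℕ → ℝ) (hdec : DECAtT x T j' M ν) :
    DECAtT x (T + 2 * (s : ℝ)) (j' + s) (M + s) (fun h => if s ≤ h then ν (h - s) else 0) := by
  classical
  obtain ⟨ρ, hρ, lam, g, lo, hi, h0, h1, hg, hlohi, hhi, hν, hval⟩ := hdec
  refine ⟨ρ, hρ, lam, g, fun r => lo r + s, fun r => hi r + s, h0, h1, hg, fun r => Nat.add_le_add_right (hlohi r) s,
    fun r => Nat.add_le_add_right (hhi r) s, fun h => ?_, fun r hr => ?_⟩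
  · show (if s ≤ h then ν (h - s) else 0) = ∑ r, lam r * TP[lo r + s, hi r + s, g r, h]
    by_cases hs : s ≤ h
    · rw [if_pos hs, hν (h - s)]
      refine Finset.sum_congr rfl fun r _ => ?_
      have e1 : (h - s = hi r) ↔ (h = hi r + s) := by omega
      have e2 : (h - s = lo r) ↔ (h = lo r + s) := by omega
      simp only [e1, e2]
    · rw [if_neg hs]
      symm
      refine Finset.sum_eq_zero fun r _ => ?_
      rw [if_neg (by omega), if_neg (by omega)]
      ring
  · show ValidAt x (T + 2 * (s : ℝ)) (j' + s) (lo r + s) (hi r + s) (g r)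
    rcases hval r hr with ⟨heq, hS⟩ | ⟨hlt, hgi, hxg⟩ | ⟨hlt, hhij, hcr⟩
    · refine Or.inl ⟨by rw [heq], ?_⟩
      rcases hS with h2 | h2
      · left; push_cast; linarith
      · right; omega
    · exact Or.inr (Or.inl ⟨by omega, by omega, hxg⟩)
    · refine Or.inr (Or.inr ⟨by omega, by omega, ?_⟩)
      have hrate : (if x ≤ g r then g r else (g r - x ^ 2) / (1 - x)) * (((hi r + s : ℕ) : ℝ) - ((lo r + s : ℕ) : ℝ))
          = (if x ≤ g r then g r else (g r - x ^ 2) / (1 - x)) * ((hi r : ℝ) - (lo r : ℝ)) := by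
        push_cast; ring
      push_cast
      nlinarith [hcr, hrate]

/-- **charged components only**: a DEC datum may be restricted to its components of positive weight. [this work] -/
theorem decAtT_iff_pos (x T : ℝ) (j' M : ℕ) (μ : ℕ → ℝ) :
    DECAtT x T j' M μ ↔
      ∃ (ρ : Type) (_ : Fintype ρ) (lam g : ρ → ℝ) (lo hi : ρ → ℕ),
        (∀ r, 0 < lam r) ∧ (∑ r, lam r = 1) ∧ (∀ r, 0 ≤ g r ∧ g r ≤ 1) ∧ (∀ r, lo r ≤ hi r) ∧ (∀ r, hi r ≤ M) ∧
        (∀ h, μ h = ∑ r, lam r * TP[lo r, hi r, g r, h]) ∧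
        (∀ r, ValidAt x T j' (lo r) (hi r) (g r)) := by
  classical
  constructor
  · rintro ⟨ρ, hρ, lam, g, lo, hi, h0, h1, hg, hlohi, hhi, hμ, hval⟩
    refine ⟨{r : ρ // 0 < lam r}, inferInstance, fun r => lam r.1, fun r => g r.1, fun r => lo r.1, fun r => hi r.1,
      fun r => r.2, ?_, fun r => hg r.1, fun r => hlohi r.1, fun r => hhi r.1, fun h => ?_, fun r => hval r.1 r.2⟩
    · have e := Finset.sum_subtype (p := fun r => 0 < lam r) (F := inferInstance) (Finset.univ.filter (fun r => 0 < lam r)) (by intro r; simp) (fun r => lam r)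
      rw [← e, Finset.sum_filter, ← h1]
      refine Finset.sum_congr rfl fun r _ => ?_
      by_cases hp : 0 < lam r
      · rw [if_pos hp]
      · rw [if_neg hp]; exact le_antisymm (h0 r) (not_lt.1 hp)
    · rw [hμ h]
      have e := Finset.sum_subtype (p := fun r => 0 < lam r) (F := inferInstance) (Finset.univ.filter (fun r => 0 < lam r)) (by intro r; simp)
        (fun r => lam r * TP[lo r, hi r, g r, h])
      rw [← e, Finset.sum_filter]
      refine Finset.sum_congr rfl fun r _ => ?_
      by_cases hp : 0 < lam r
      · rw [if_pos hp]
      · rw [if_neg hp, ← le_antisymm (h0 r) (not_lt.1 hp), zero_mul]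
  · rintro ⟨ρ, hρ, lam, g, lo, hi, h0, h1, hg, hlohi, hhi, hμ, hval⟩
    exact ⟨ρ, hρ, lam, g, lo, hi, fun r => (h0 r).le, h1, hg, hlohi, hhi, hμ, fun r _ => hval r⟩

/-- **FINITE MIXTURES AT A COMMON TARGET.**  If `μ = Σ_r w_r·ν_r` on an index `Fintype`, `w ≥ 0`, `Σ w = 1`, and every charged
law `ν_r` (`w_r > 0`) is DEC(j′) at target `T` on `{0..M}`, then `μ` is DEC(j′) at target `T` on `{0..M}`. [this work] -/
theorem decAtT_finite_mixture {ι : Type} [Fintype ι] (x T : ℝ) (j' M : ℕ) (μ : ℕ → ℝ) (w : ι → ℝ) (ν : ι → ℕ → ℝ)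
    (hw0 : ∀ i, 0 ≤ w i) (hw1 : ∑ i, w i = 1) (hμ : ∀ h, μ h = ∑ i, w i * ν i h)
    (hdec : ∀ i, 0 < w i → DECAtT x T j' M (ν i)) : DECAtT x T j' M μ := by
  classical
  -- restrict to charged indices and choose a positive-weight decomposition for each
  have hdec' : ∀ i : {i : ι // 0 < w i}, ∃ (ρ : Type) (_ : Fintype ρ) (lam g : ρ → ℝ) (lo hi : ρ → ℕ),
      (∀ r, 0 < lam r) ∧ (∑ r, lam r = 1) ∧ (∀ r, 0 ≤ g r ∧ g r ≤ 1) ∧ (∀ r, lo r ≤ hi r) ∧ (∀ r, hi r ≤ M) ∧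
      (∀ h, ν i.1 h = ∑ r, lam r * TP[lo r, hi r, g r, h]) ∧ (∀ r, ValidAt x T j' (lo r) (hi r) (g r)) :=
    fun i => (decAtT_iff_pos x T j' M (ν i.1)).1 (hdec i.1 i.2)
  choose ρf hfin lam g lo hi h0 h1 hg hlohi hhi hν hval using hdec'
  letI : ∀ i, Fintype (ρf i) := hfin
  refine ⟨(Σ i : {i : ι // 0 < w i}, ρf i), inferInstance, fun p => w p.1.1 * lam p.1 p.2, fun p => g p.1 p.2,
    fun p => lo p.1 p.2, fun p => hi p.1 p.2, fun p => (mul_pos p.1.2 (h0 p.1 p.2)).le, ?_, fun p => hg p.1 p.2,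
    fun p => hlohi p.1 p.2, fun p => hhi p.1 p.2, fun h => ?_, fun p _ => hval p.1 p.2⟩
  · -- total weight
    rw [Fintype.sum_sigma]
    have e : ∀ i : {i : ι // 0 < w i}, ∑ r : ρf i, w i.1 * lam i r = w i.1 := fun i => by
      rw [← Finset.mul_sum, h1 i, mul_one]
    simp only [e]
    have e2 := Finset.sum_subtype (p := fun i => 0 < w i) (F := inferInstance) (Finset.univ.filter (fun i => 0 < w i)) (by intro i; simp) (fun i => w i)
    rw [← e2, Finset.sum_filter, ← hw1]
    refine Finset.sum_congr rfl fun i _ => ?_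
    by_cases hp : 0 < w i
    · rw [if_pos hp]
    · rw [if_neg hp]; exact le_antisymm (hw0 i) (not_lt.1 hp)
  · -- mixture identity
    rw [hμ h, Fintype.sum_sigma]
    have e : ∀ i : {i : ι // 0 < w i}, ∑ r : ρf i, w i.1 * lam i r * TP[lo i r, hi i r, g i r, h] = w i.1 * ν i.1 h := by
      intro i
      rw [hν i h, Finset.mul_sum]
      refine Finset.sum_congr rfl fun r _ => ?_
      ring
    simp only [e]
    have e2 := Finset.sum_subtype (p := fun i => 0 < w i) (F := inferInstance) (Finset.univ.filter (fun i => 0 < w i)) (by intro i; simp) (fun i => w i * ν i h)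
    rw [← e2, Finset.sum_filter]
    refine Finset.sum_congr rfl fun i _ => ?_
    by_cases hp : 0 < w i
    · rw [if_pos hp]
    · rw [if_neg hp, ← le_antisymm (hw0 i) (not_lt.1 hp), zero_mul]

end LawDec

end Quant

end Summit.CriticalPhenomena.PercolationContinuityZ3.Theorems
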